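import Summits.SmoothPoincare4.SmoothPoincare4.Theorems.SullivanDualWitnessChargeHelperRescaleLocal
import Summits.SmoothPoincare4.SmoothPoincare4.Theorems.SullivanDualWitnessChargeHelperRescaleAway
import Summits.SmoothPoincare4.SmoothPoincare4.Theorems.SullivanDualWitnessChargeWeierstrass
import Literature.Analysis.FunctionSpaces.EquicontinuousExtraction
import Mathlib.Analysis.Complex.Basic

/-!
# Helper `helper_limitExtract` of line `Sketch` (pencil-incompleteness) for crux `WitnessCharge`
(item stmt-SmoothPoincare4-7824; route `SullivanDual`, crux
`Summit.SmoothPoincare4.SmoothPoincare4.Theses.SullivanDual.WitnessCharge`; line `Sketch`,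
stub `helper_limitExtract` — branch (N) of the pencil closedness argument: extraction of a
locally uniformly convergent subsequence of entire `J`-curves and regularity of the limit)

**Extraction.** Let `Σ` be a homotopy `4`-sphere, `p ∈ Σ`, `J` an almost complex structure on
`Σ ∖ p` with smooth frame expressions, `ι : Σ → ℝᴺ` a `C^∞` injective immersion, and
`u n : ℂ → Σ ∖ p` entire `J`-curves which on every disc `{‖ξ‖ ≤ r}` take values in a compact
subset `K_r ⊆ Σ ∖ p` and have gradients (through `ι`) bounded by `L_r`. Then a subsequence
`u (φ k)` converges, through `ι` and uniformly on compact subsets of `ℂ`, to `ι ∘ G` for a `C^∞`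
`J`-holomorphic map `G : ℂ → Σ ∖ p`.

Proof.
1. The flat maps `f n = ι ∘ u n : ℂ → ℝᴺ` are `C^∞` (`contDiff_embed_comp`), take values in the
   compact `range ι`, and are `L_r`-Lipschitz on the disc of radius `r` (mean value inequality);
   hence the sequence is equicontinuous and pointwise bounded.
2. Sequential Arzelà–Ascoli
   (`Literature.Analysis.FunctionSpaces.exists_strictMono_tendstoLocallyUniformlyOn_of_equicontinuousOn`
   on `U = univ`) extracts `φ` and a continuous `v : ℂ → ℝᴺ` with `f (φ k) → v` locally uniformly.
3. `v ζ` lies in the compact `ι(K_r)` (`r = ‖ζ‖`), so `v = ι ∘ G` with `G : ℂ → Σ ∖ p`, continuous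
   because `ι` restricted to `Σ ∖ p` is an embedding.
4. `helper_rescaleLocal` (with the proved generalized Weierstraß theorem
   `jHolomorphicWeierstrassR4_holds`) at every point: `G` is `C^∞` and `J`-holomorphic.
-/

noncomputable section

set_option linter.dupNamespace false

open scoped Manifold ContDiff Topology
open Set Filter Literature.Geometry.Kaehler Literature.Geometry.Symplectic
  Literature.Topology.FourManifolds

namespace Summit.SmoothPoincare4.SmoothPoincare4.Theorems.WitnessCharge.PencilIncompleteness

/-- **Extraction of a locally uniform limit of entire `J`-curves (branch (N)).** Entire
`J`-curves `u n : ℂ → Σ ∖ p` confined to compact sets on discs and with gradients (through a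
`C^∞` injective immersion `ι : Σ → ℝᴺ`) bounded on discs have a subsequence converging, through
`ι` and uniformly on compact subsets of `ℂ`, to `ι ∘ G` for a `C^∞` `J`-holomorphic
`G : ℂ → Σ ∖ p` (equicontinuity by the mean value inequality, sequential Arzelà–Ascoli, lift of
the limit through the embedding, local regularity `helper_rescaleLocal`). -/
theorem helper_limitExtract :
    ∀ (S : HomotopySphere 4) (p : S.carrier)
      (J : ∀ x : punctured p, TangentSpace (𝓡 4) x →L[ℝ] TangentSpace (𝓡 4) x),
      (∀ (x : punctured p) (v : TangentSpace (𝓡 4) x), J x (J x v) = -v) →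
      (∀ x₀ : punctured p, ContMDiffAt (𝓡 4) 𝓘(ℝ, EuclideanSpace ℝ (Fin 4) →L[ℝ] EuclideanSpace ℝ (Fin 4)) ∞
        (inTangentCoordinates (𝓡 4) (𝓡 4) (id : punctured p → punctured p) id (fun x => J x) x₀) x₀) →
      ∀ (N : ℕ) (ι : S.carrier → EuclideanSpace ℝ (Fin N)),
        ContMDiff (𝓡 4) 𝓘(ℝ, EuclideanSpace ℝ (Fin N)) ∞ ι → Function.Injective ι →
        (∀ x : S.carrier, Function.Injective (mfderiv (𝓡 4) 𝓘(ℝ, EuclideanSpace ℝ (Fin N)) ι x)) →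
      ∀ (u : ℕ → ℂ → punctured p), (∀ n, IsEntireJCurve (𝓡 4) J (u n)) →
        (∀ r : ℝ, ∃ K : Set (punctured p), IsCompact K ∧ ∀ n (ξ : ℂ), ‖ξ‖ ≤ r → u n ξ ∈ K) →
        (∀ r : ℝ, ∃ L : ℝ, ∀ n (ξ : ℂ), ‖ξ‖ ≤ r →
          ‖fderiv ℝ (fun w : ℂ => ι (u n w).1) ξ‖ ≤ L) →
        ∃ (G : ℂ → punctured p) (φ : ℕ → ℕ), StrictMono φ ∧
          ContMDiff 𝓘(ℝ, ℂ) (𝓡 4) ∞ G ∧ IsJHolomorphic (𝓡 4) J G ∧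
          ∀ D : Set ℂ, IsCompact D →
            TendstoUniformlyOn (fun k ζ => ι (u (φ k) ζ).1) (fun ζ => ι (G ζ).1) atTop D := by
  intro S p J hJ2 hJs N ι hι hιinj _hιd u hu hK hgrad
  -- Step 1: the flat maps `f n = ι ∘ u n : ℂ → ℝᴺ`
  obtain ⟨f, hfdef⟩ : ∃ f : ℕ → ℂ → EuclideanSpace ℝ (Fin N),
      ∀ n ξ, f n ξ = ι (u n ξ).1 := ⟨_, fun _ _ => rfl⟩
  have hfeq : ∀ n, f n = fun ξ => ι (u n ξ).1 := fun n => funext (hfdef n)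
  have hfsmooth : ∀ n, ContDiff ℝ ∞ (f n) := fun n => by
    rw [hfeq]
    exact contDiff_embed_comp hι (hu n).contMDiff
  have hfdiff : ∀ n, Differentiable ℝ (f n) := fun n => (hfsmooth n).differentiable (by simp)
  -- equi-Lipschitz on discs (mean value inequality)
  have hlip : ∀ r : ℝ, ∃ L : ℝ, ∀ n (ζ ζ' : ℂ), ‖ζ‖ ≤ r → ‖ζ'‖ ≤ r →
      ‖f n ζ - f n ζ'‖ ≤ L * ‖ζ - ζ'‖ := fun r => by
    obtain ⟨L, hL⟩ := hgrad r
    refine ⟨L, fun n ζ ζ' hζ hζ' => ?_⟩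
    refine Convex.norm_image_sub_le_of_norm_fderiv_le (f := f n) (s := Metric.closedBall (0 : ℂ) r)
      (fun x _ => hfdiff n x) (fun x hx => ?_) (convex_closedBall 0 r)
      (mem_closedBall_zero_iff.2 hζ') (mem_closedBall_zero_iff.2 hζ)
    rw [hfeq]
    exact hL n x (mem_closedBall_zero_iff.1 hx)
  -- equicontinuity on `ℂ`
  have hequi : Equicontinuous f := fun ζ₀ => by
    obtain ⟨L, hL⟩ := hlip (‖ζ₀‖ + 1)
    refine Metric.equicontinuousAt_of_continuity_modulus (fun x => L * dist x ζ₀) ?_ f ?_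
    · have hc : Continuous fun x : ℂ => L * dist x ζ₀ :=
        continuous_const.mul (continuous_id.dist continuous_const)
      simpa using hc.tendsto ζ₀
    · filter_upwards [Metric.ball_mem_nhds ζ₀ one_pos] with x hx
      intro i
      have hx1 : ‖x - ζ₀‖ < 1 := by rwa [← dist_eq_norm]
      have hxr : ‖x‖ ≤ ‖ζ₀‖ + 1 :=
        calc ‖x‖ ≤ ‖ζ₀‖ + ‖x - ζ₀‖ := norm_le_norm_add_norm_sub' x ζ₀
          _ ≤ ‖ζ₀‖ + 1 := by linarith
      have hζr : ‖ζ₀‖ ≤ ‖ζ₀‖ + 1 := by linarith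
      calc dist (f i ζ₀) (f i x) = ‖f i ζ₀ - f i x‖ := dist_eq_norm _ _
        _ ≤ L * ‖ζ₀ - x‖ := hL i ζ₀ x hζr hxr
        _ = L * dist x ζ₀ := by rw [norm_sub_rev, dist_eq_norm]
  -- pointwise boundedness: all values lie in the compact `range ι`
  obtain ⟨R, hR⟩ := (isCompact_range hι.continuous).isBounded.subset_closedBall
    (0 : EuclideanSpace ℝ (Fin N))
  have hb : ∀ x ∈ (univ : Set ℂ), ∃ (y₀ : EuclideanSpace ℝ (Fin N)) (M : ℝ),
      ∀ n, dist (f n x) y₀ ≤ M := fun x _ =>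
    ⟨0, R, fun n => by
      rw [hfdef]
      exact Metric.mem_closedBall.1 (hR (mem_range_self _))⟩
  -- Step 2: sequential Arzelà–Ascoli extraction in `ℝᴺ`
  obtain ⟨v, φ, hφ, hvcont, hconv⟩ :=
    Literature.Analysis.FunctionSpaces.exists_strictMono_tendstoLocallyUniformlyOn_of_equicontinuousOn
      isOpen_univ ((equicontinuousOn_univ f).2 hequi) hb
  have hconv' : TendstoLocallyUniformly (fun n => f (φ n)) v atTop :=
    tendstoLocallyUniformlyOn_univ.1 hconv
  have hvc : Continuous v := continuousOn_univ.1 hvcont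
  -- Step 3: lift the limit `v` to `G : ℂ → Σ ∖ p`
  have hlim : ∀ ζ : ℂ, Tendsto (fun k => f (φ k) ζ) atTop (𝓝 (v ζ)) := fun ζ =>
    (hconv'.tendstoLocallyUniformlyOn (s := univ)).tendsto_at (mem_univ ζ)
  have hvK : ∀ ζ : ℂ, ∃ x : punctured p, ι x.1 = v ζ := fun ζ => by
    obtain ⟨K, hKc, hKu⟩ := hK ‖ζ‖
    have hK'c : IsCompact ((fun x : punctured p => ι x.1) '' K) :=
      hKc.image (hι.continuous.comp continuous_subtype_val)
    have hmem : v ζ ∈ (fun x : punctured p => ι x.1) '' K :=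
      hK'c.isClosed.mem_of_tendsto (hlim ζ)
        (Eventually.of_forall fun k => ⟨u (φ k) ζ, hKu (φ k) ζ le_rfl, (hfdef (φ k) ζ).symm⟩)
    obtain ⟨x, -, hxv⟩ := hmem
    exact ⟨x, hxv⟩
  choose G hGv using hvK
  have hemb : Topology.IsEmbedding (fun x : punctured p => ι x.1) :=
    (hι.continuous.isClosedEmbedding hιinj).isEmbedding.comp Topology.IsEmbedding.subtypeVal
  have hGcont : Continuous G :=
    hemb.continuous_iff.2 (hvc.congr fun ζ => (hGv ζ).symm)
  have hF : (fun n => f (φ n)) = fun k ζ => ι (u (φ k) ζ).1 := funext fun k => hfeq (φ k)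
  have hconvG : TendstoLocallyUniformly (fun k ζ => ι (u (φ k) ζ).1) (fun ζ => ι (G ζ).1)
      atTop := by
    rw [← hF]
    exact hconv'.congr_right fun ζ => (hGv ζ).symm
  have hunif : ∀ D : Set ℂ, IsCompact D →
      TendstoUniformlyOn (fun k ζ => ι (u (φ k) ζ).1) (fun ζ => ι (G ζ).1) atTop D :=
    fun D hD => (tendstoLocallyUniformly_iff_forall_isCompact.1 hconvG) D hD
  -- Step 4: local regularity at every point
  have hL := fun ζ₀ : ℂ => helper_rescaleLocal jHolomorphicWeierstrassR4_holds S p J hJ2 hJs N ι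
    hι hιinj (fun j => u (φ j)) G ζ₀ (fun j => hu (φ j)) hGcont hunif
  have hGsmooth : ContMDiff 𝓘(ℝ, ℂ) (𝓡 4) ∞ G := fun ζ₀ => (hL ζ₀).1
  have hGhol : IsJHolomorphic (𝓡 4) J G := fun ζ₀ η => (hL ζ₀).2.1 η
  exact ⟨G, φ, hφ, hGsmooth, hGhol, hunif⟩

end Summit.SmoothPoincare4.SmoothPoincare4.Theorems.WitnessCharge.PencilIncompleteness
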